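import Summits.HodgeConjecture.HodgeConjecture.Theorems.K2LiuInertFrameInputsIntegral
import Summits.HodgeConjecture.HodgeConjecture.Theorems.K2LiuDoublingEigenfunctionalUpstairs
import Summits.HodgeConjecture.HodgeConjecture.Theorems.K2LiuDoublingEigenfunctionalNonvanishing
import Summits.HodgeConjecture.HodgeConjecture.Theorems.K2LiuIntegralSwap
import Summits.HodgeConjecture.HodgeConjecture.Theorems.K2LiuInertSiegelScalars
import Summits.HodgeConjecture.HodgeConjecture.Theorems.F0P2oDoubledSwapSiegel
import Literature.NumberTheory.GelbartRogawski1991.LocalDoubledUnitaryDeltaTransport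
import Literature.NumberTheory.GelbartRogawski1991.LocalLeraySection
import Literature.NumberTheory.GelbartRogawski1991.LocalUnitarySplittingsCM
import Literature.NumberTheory.GelbartRogawski1991.DoubledUnitaryGlobalSplittingData
import Literature.NumberTheory.Weil1964.DoublingDiagonalPolarisation
import Literature.NumberTheory.Automorphic.HeckeAlgebra

/-!
# THE θ-TYPE SPHERICAL EIGENVALUE AT A GOOD INERT PLACE, UPSTAIRS: `T(t₁) 1_{𝒪^{n′}} = (q(Z + Z⁻¹) + q − 1) · 1_{𝒪^{n′}}` for the local Weil
# representation `ω_v ∘ s_v ∘ (· ⊗ 1_W)` of `U(V)(L⁺_v)` (LOCAL SEAM of s23, inert package, organ (L24-b) (Σ) — the assembly of ROAD A′)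

Track B ∕ K2-LIT, hLiu418 = stmt-HodgeConjecture-24832; LEAD F0P6-plan (g11) «M-155g» (ii) ∕ «M-155i» ((L24-b) «eigenvalue of `T(t₁)` on `[𝟙_𝒪]` by
ROAD A′», MY HEAD fixed by M-155i: UPSTAIRS on `ω_v`, no coinvariants).  Helper (count-neutral, own head per LEAD R3); consumed by K2Liu-p04's (L24-c) assembly
of socket #24i `sig_K2LiuThetaTypeSphericalEigenvalueInert` together with K2Liu-p05's (L24-a) line lemma (the hypothesis `hline` below).  THEOREMS ONLY.

THE STATEMENT `heckeOperator_unitVec_eq_smul_inert`.  Data: the K2Lit CURVE datum `V = ⟨dV⟩` (`N = 2`, `dV` real non-zero), the line `W = ⟨a⟩`, an enumeration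
`e₁ : Fin 2 × Fin 1 ≃ Fin n′`, the Gram matrix `T₀ = gram e₁ diag(dV) (a)` and `J = reindex e₁ (diag dV ⊗ (a)) = T₀ ⊗ 1`; a unitary splitting character `χ`
(`IsSplittingChar L 1 χ`); Haar data `μ` on `L⁺_v`; the local Weil representation `ω_v = toRep ∘ s_v`, `s_v = localSplittingCMWith L n′ hT₀ hT₀d hJ χ hχ v μ`
(= the CM package's `𝓢.s v`, ★ `congrW_undoubledSplittings_cmFinLocalFamily_s`), pulled back to `G_v = U(V)(L⁺_v)` along `x ↦ x ⊗ 1_W` (★ `localLineInl`);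
#28i's place∕frame block at an INERT UNRAMIFIED `v` (`w`, `hw`, `hv`, `ϖ`, `hϖ`, `hϖσ`, `T ∈ GL₂(𝒪_w)`, `hTJ`, `t₁`, `ht₁`); `a` a unit at `w` (`ha`); `v` GOOD for the
doubled CM datum (★ `IsGoodPlace`: `v ∤ 2`, `δ`, `T₀` unimodular at `v`, `χ` unramified above `v`, `ψ_v` of conductor `𝒪_v` — cofinitely many `v`, ★
`eventually_isGoodPlace_localComponent_inv`); and (L24-a) as a hypothesis `hline : ω^{K_v} ⊆ ℂ · 1_{𝒪^{n′}}`.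
CONCLUSION: **`heckeOperator (ω_v ∘ s_v ∘ localLineInl) K_v t₁ 1_{𝒪^{n′}} = (q·(Z + Z⁻¹) + q − 1) • 1_{𝒪^{n′}}`**, `q = q_v`, `Z = χ_w(ϖ)`
(`χ.localComponent w.1` at the unit `ϖ`; the socket's `valueAtUniformizer` for `χ` unramified at `w`).

THE PROOF (every input ★, this lineage): ★ (T)+(F2′) `exists_frameInputs_integral_inert` (transversal `X₊ ⊔ X₀ ⊔ {t₁⁻¹}`, frame `(y, y*)`, eigenvalues
`ϖ ∣ 1 ∣ ϖ⁻¹`, integrality); ★ `heckeOperator_apply_eq_sum` + `hline` ⇒ `T 1 = a • 1`; ★ (C3′) `isSiegelDelta_swap_inlLoc_swap` ∕ `detDelta_swap_inlLoc_swap`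
(swap `w₀`, Siegel memberships, `det_Δ = α`); mover `m₀` (★ `map_transportSp_deltaDiag_deltaLagrangian` + ★ `existsImplementer_localSchrodinger`); ★ (Λ-c)
`w₀ ∈ H(𝒪_v)` + ★ (Λ-b) `λ′(1 ⊠ 1) ≠ 0` + ★ (Λ-a) extraction ⇒ `a = Σ_x e_x`; ★ (Σ-a) scalars: `e = Z q⁻¹ ∣ 1 ∣ Z⁻¹ q` on `X₊ ∣ X₀ ∣ t₁⁻¹`, pieces disjoint,
`|X₊| = q²`, `|X₀| = q − 1` ⇒ `a = q(Z + Z⁻¹) + q − 1`.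
[GelbartRogawski1991, §3.2 (3.2.2) p. 457]; [Kudla1994, §3 Thm. 3.1]; [HarrisKudlaSweet1996, §1 (1.15)–(1.16)]; [BruhatTits1972, (4.4.4)]; [Macdonald1971, V §3].
HONEST LABEL: HC_CM is proved only modulo the printed citations (2 remaining named inputs: hLiu418 = stmt-HodgeConjecture-24832, h413 =
stmt-HodgeConjecture-24833) until rung 0 closes; this file is unconditional and moves no counter.
-/

set_option autoImplicit false

set_option linter.dupNamespace false

noncomputable section

open scoped Matrix Kronecker Pointwise Valued
open NumberField IsDedekindDomain Matrix MulAction MeasureTheory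
open Literature.RepresentationTheory.HeisenbergGroup Literature.RepresentationTheory.HeisenbergGroup.SymplecticMatrix
open Literature.NumberTheory.Automorphic Literature.NumberTheory.Automorphic.UnitaryGroup Literature.NumberTheory.Automorphic.CartanUnique
open Literature.NumberTheory.Automorphic.Liu2021 Literature.NumberTheory.Automorphic.Liu2021.Def411WeilCarriers
open Literature.NumberTheory.Weil1964
open Literature.NumberTheory.GaloisRepresentations Literature.RepresentationTheory.HarrisKudlaSweet1996
open Literature.NumberTheory.GelbartRogawski1991 Literature.NumberTheory.GelbartRogawski1991.GRConstruction
open Literature.NumberTheory.GelbartRogawski1991.UnitaryDualPair Literature.NumberTheory.GelbartRogawski1991.UnitaryDualPair.LocalSplitting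
open Summit.HodgeConjecture.HodgeConjecture.Cruxes.HLiu418.K2LiuInertFrameInputs
open Summit.HodgeConjecture.HodgeConjecture.Cruxes.HLiu418.K2LiuInertFrameInputsIntegral
open Summit.HodgeConjecture.HodgeConjecture.Cruxes.HLiu418.K2LiuDoublingEigenfunctionalUpstairs
open Summit.HodgeConjecture.HodgeConjecture.Cruxes.HLiu418.K2LiuDoublingEigenfunctionalNonvanishing
open Summit.HodgeConjecture.HodgeConjecture.Cruxes.HLiu418.K2LiuIntegralSwap
open Summit.HodgeConjecture.HodgeConjecture.Cruxes.HLiu418.K2LiuInertSiegelScalars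
open Summit.HodgeConjecture.HodgeConjecture.Cruxes.H413.F0P2oDoubledSwapSiegel

namespace Summit.HodgeConjecture.HodgeConjecture.Cruxes.HLiu418.K2LiuInertThetaSphericalEigenvalue

variable (L : Type) [Field L] [NumberField L] [IsCMField L]

set_option maxHeartbeats 4000000 in -- the doubled CM datum's telescope (as ★ `LocalSplittingCMParabolicEigenfunctional`, ★ (Λ-a), ★ (Λ-b))
/-- **THE θ-TYPE SPHERICAL EIGENVALUE AT A GOOD INERT PLACE, UPSTAIRS** (see the module docstring):
`T(t₁) 1_{𝒪^{n′}} = (q(Z + Z⁻¹) + q − 1) · 1_{𝒪^{n′}}` on the local Weil representation `ω_v ∘ s_v ∘ (· ⊗ 1_W)` of `U(V)(L⁺_v)`, `Z = χ_w(ϖ)`.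
[cite: GelbartRogawski1991, §3.2 (3.2.2) p. 457] [cite: Kudla1994, §3 Thm. 3.1] [cite: HarrisKudlaSweet1996, §1 (1.15)–(1.16)] [cite: BruhatTits1972, (4.4.4)] -/
theorem heckeOperator_unitVec_eq_smul_inert (dV : Fin 2 → L) (v : HeightOneSpectrum (𝓞 (Fp L)))
    [DecidableEq (UnitaryGroup.localPi L (IsCMField.complexConj L) 2 (Matrix.diagonal dV) v)]
    (hdV : ∀ i, IsCMField.complexConj L (dV i) = dV i) (hdV0 : ∀ i, dV i ≠ 0) {n' : ℕ} (e₁ : Fin 2 × Fin 1 ≃ Fin n') (a : (Fp L)ˣ)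
    [MeasurableSpace (v.adicCompletion (Fp L))] [BorelSpace (v.adicCompletion (Fp L))]
    (μ : Measure (v.adicCompletion (Fp L))) [μ.IsAddHaarMeasure]
    (χ : HeckeCharacter L) (hχ : IsSplittingChar L 1 χ)
    (w : UnitaryGroup.PlacesOver L v) (hw : IsCMField.complexConj L • w.1 = w.1)
    (hv : Algebra.IsUnramifiedIn (𝓞 L) v.asIdeal)
    {ϖ : w.1.adicCompletion L} (hϖ : Valued.v ϖ = WithZero.exp (-1 : ℤ))
    (hϖσ : galAdicCompletionMap (L := L) (IsCMField.complexConj L) hw ϖ = ϖ)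
    (T : GL (Fin 2) (w.1.adicCompletion L)) (hTi : T ∈ glInt 2 (w.1.adicCompletion L))
    (hTJ : UnitaryGroup.placeForm (Matrix.diagonal dV) w.1 =
      formCongr (galAdicCompletionMap (L := L) (IsCMField.complexConj L) hw) T ((StdForm.antidiagonal 2).over (w.1.adicCompletion L)))
    (t₁ : UnitaryGroup.localPi L (IsCMField.complexConj L) 2 (Matrix.diagonal dV) v)
    (ht₁ : Units.val ((t₁ : UnitaryGroup.LocalGLPi L 2 v) w) =
      ((T⁻¹ : GL (Fin 2) (w.1.adicCompletion L)) : Matrix (Fin 2) (Fin 2) (w.1.adicCompletion L)) *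
        Matrix.diagonal ![ϖ, ϖ⁻¹] * (T : Matrix (Fin 2) (Fin 2) (w.1.adicCompletion L)))
    (ha : Valued.v ((algebraMap (Fp L) L (a : Fp L) : L) : w.1.adicCompletion L) = 1)
    (hgood : IsGoodPlace (Fp L) L (imagUnit L) v n' (gram (Fp L) e₁ (realDiagonal L dV hdV) (TW (Fp L) a))
      (fun w' : UnitaryGroup.PlacesOver L v => (χ.localComponent w'.1)⁻¹))
    (hline : ∀ f ∈ Representation.fixedPoints
        (((MpPsi.toRep (localSchrodinger (Fp L) n' (gram (Fp L) e₁ (realDiagonal L dV hdV) (TW (Fp L) a)) v)).comp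
          (localSplittingCMWith L n' (isSymm_gram (Fp L) e₁ (realDiagonal_isSymm L dV hdV) (isSymm_TW (Fp L) a))
            (isUnit_det_gram (Fp L) e₁ (isUnit_det_realDiagonal L dV hdV hdV0) (isUnit_det_TW (Fp L) a))
            (reindex_kronecker_eq_gram_map (Fp L) L e₁ (realDiagonal_map L dV hdV).symm (JW_eq (Fp L) L a)) χ hχ v μ)).comp
          (localLineInl L (IsCMField.complexConj L) 2 e₁ (Matrix.diagonal dV) (JW (Fp L) L a) v) :
          Representation ℂ (UnitaryGroup.localPi L (IsCMField.complexConj L) 2 (Matrix.diagonal dV) v)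
            (SchwartzBruhat (Fin n' → v.adicCompletion (Fp L))))
        (UnitaryGroup.localInt L (IsCMField.complexConj L) 2 (Matrix.diagonal dV) v),
      ∃ c : ℂ, f = c • unitVec (Fp L) (Fin n') v) :
    heckeOperator
        (((MpPsi.toRep (localSchrodinger (Fp L) n' (gram (Fp L) e₁ (realDiagonal L dV hdV) (TW (Fp L) a)) v)).comp
          (localSplittingCMWith L n' (isSymm_gram (Fp L) e₁ (realDiagonal_isSymm L dV hdV) (isSymm_TW (Fp L) a))
            (isUnit_det_gram (Fp L) e₁ (isUnit_det_realDiagonal L dV hdV hdV0) (isUnit_det_TW (Fp L) a))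
            (reindex_kronecker_eq_gram_map (Fp L) L e₁ (realDiagonal_map L dV hdV).symm (JW_eq (Fp L) L a)) χ hχ v μ)).comp
          (localLineInl L (IsCMField.complexConj L) 2 e₁ (Matrix.diagonal dV) (JW (Fp L) L a) v))
        (UnitaryGroup.localInt L (IsCMField.complexConj L) 2 (Matrix.diagonal dV) v) t₁ (unitVec (Fp L) (Fin n') v) =
      ((v.residueCard : ℂ) * (((χ.localComponent w.1 (Units.mk0 ϖ (uniformizer_ne_zero hϖ)) : ℂˣ) : ℂ) +
          (((χ.localComponent w.1 (Units.mk0 ϖ (uniformizer_ne_zero hϖ)) : ℂˣ) : ℂ))⁻¹) + (v.residueCard : ℂ) - 1) •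
        unitVec (Fp L) (Fin n') v := by
  classical
  haveI : Algebra.IsQuadraticExtension (Fp L) L := IsCMField.isQuadraticExtension L
  have hc : IsCMField.complexConj L ≠ 1 := IsCMField.complexConj_ne_one L
  -- abbreviations (all `set`, so that the hypotheses are rewritten too)
  set T₀ : Matrix (Fin n') (Fin n') (Fp L) := gram (Fp L) e₁ (realDiagonal L dV hdV) (TW (Fp L) a) with hT₀def
  set hT₀ : T₀.IsSymm := isSymm_gram (Fp L) e₁ (realDiagonal_isSymm L dV hdV) (isSymm_TW (Fp L) a) with hT₀proof
  set hT₀d : IsUnit T₀.det := isUnit_det_gram (Fp L) e₁ (isUnit_det_realDiagonal L dV hdV hdV0) (isUnit_det_TW (Fp L) a) with hT₀dproof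
  set hJ : Matrix.reindex e₁ e₁ (Matrix.diagonal dV ⊗ₖ JW (Fp L) L a) = T₀.map (algebraMap (Fp L) L) :=
    reindex_kronecker_eq_gram_map (Fp L) L e₁ (realDiagonal_map L dV hdV).symm (JW_eq (Fp L) L a) with hJproof
  set s := localSplittingCMWith L n' hT₀ hT₀d hJ χ hχ v μ with hsdef
  set ω : Representation ℂ (UnitaryGroup.localPi L (IsCMField.complexConj L) n' (Matrix.reindex e₁ e₁ (Matrix.diagonal dV ⊗ₖ JW (Fp L) L a)) v)
      (SchwartzBruhat (Fin n' → v.adicCompletion (Fp L))) := (MpPsi.toRep (localSchrodinger (Fp L) n' T₀ v)).comp s with hωdef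
  set ch := localLineInl L (IsCMField.complexConj L) 2 e₁ (Matrix.diagonal dV) (JW (Fp L) L a) v with hchdef
  set Kv := UnitaryGroup.localInt L (IsCMField.complexConj L) 2 (Matrix.diagonal dV) v with hKvdef
  set Φ₁ := unitVec (Fp L) (Fin n') v with hΦ₁def
  set Z : ℂ := (((χ.localComponent w.1 (Units.mk0 ϖ (uniformizer_ne_zero hϖ)) : ℂˣ) : ℂ)) with hZdef
  set q : ℕ := v.residueCard with hqdef
  -- (1) the frame inputs with integrality ★ (F2′)
  obtain ⟨Xp, X0, hX, hcp, hc0, y, ys, αp, αm, hyy, hsy, hys, hlineY, hyI, hysI, hαp, hαm, hXp, hX0, hti⟩ :=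
    exists_frameInputs_integral_inert L dV v hdV e₁ a w hw hv hϖ hϖσ T hTi hTJ t₁ ht₁ ha
  -- (2) `1_{𝒪^{n'}}` is `K_v`-fixed (good place), the Hecke sum, the eigenvalue `a₀` from (L24-a)
  have honeK : Φ₁ ∈ Representation.fixedPoints (ω.comp ch) Kv := by
    refine (Representation.mem_fixedPoints _ _ _).2 fun k hk => ?_
    change MpPsi.toRep (localSchrodinger (Fp L) n' T₀ v) (s (ch k)) Φ₁ = Φ₁
    exact localSplittingCMWith_unitVec L n' hT₀ hT₀d hJ χ hχ v μ hgood _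
      (localLineInl_mapsTo_localInt L (IsCMField.complexConj L) 2 e₁ (Matrix.diagonal dV) (JW (Fp L) L a) v hk)
  have hsum0 := heckeOperator_apply_eq_sum (ω.comp ch) Kv t₁ (Xp ∪ X0 ∪ {t₁⁻¹}) hX honeK
  have hfin : (orbit Kv (t₁ : UnitaryGroup.localPi L (IsCMField.complexConj L) 2 (Matrix.diagonal dV) v ⧸ Kv)).Finite := by
    rw [← hX.image_eq]; exact (Finset.finite_toSet _).image _
  obtain ⟨a₀, ha₀⟩ := hline _ (heckeOperator_apply_mem_fixedPoints (ω.comp ch) Kv t₁ honeK hfin)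
  rw [ha₀]
  congr 1
  -- (3) ★ (C3′): the swap `w₀` of the frame `(y, y*)`, Siegel memberships and `det_Δ` for every member
  set w₀ := localSwapElt L (IsCMField.complexConj L) (n' + n') ((gramD (Fp L) n' T₀).map (algebraMap (Fp L) L)) v
      (complexConj_imagUnit L) (imagUnit_ne_zero L) (conjTranspose_hermD (Fp L) L (IsCMField.complexConj L) n' rfl hT₀)
      (hermForm_localFormD_swapVector (Fp L) L (IsCMField.complexConj L) v n' rfl hyy hsy hys) with hw₀def
  have hw₀ : w₀ * w₀ = 1 :=
    localSwapElt_mul_self (Fp L) L (IsCMField.complexConj L) v (complexConj_imagUnit L) (imagUnit_ne_zero L) _ _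
  have hSieg : ∀ (x : UnitaryGroup.localPi L (IsCMField.complexConj L) 2 (Matrix.diagonal dV) v) (α : UnitaryGroup.LocalRing L v),
      (((localPiEquiv L (IsCMField.complexConj L) n' (Matrix.reindex e₁ e₁ (Matrix.diagonal dV ⊗ₖ JW (Fp L) L a)) v (ch x)).1 :
          GL (Fin n') (UnitaryGroup.LocalRing L v)).1) *ᵥ y = α • y →
      IsSiegelDelta (Fp L) L (IsCMField.complexConj L) (complexConj_imagUnit L) (imagUnit_ne_zero L) (imagUnit_mul_self L) v n' hT₀ rfl
          (w₀ * inlLoc (Fp L) L (IsCMField.complexConj L) v n' hJ rfl (ch x) * w₀) ∧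
        ∀ w' : UnitaryGroup.PlacesOver L v, detDelta (Fp L) L (IsCMField.complexConj L) v n' w'
          (w₀ * inlLoc (Fp L) L (IsCMField.complexConj L) v n' hJ rfl (ch x) * w₀) = α w' := by
    intro x α hgy
    have hgb := exists_mulVec_eq_add_smul_of_line _ hgy hlineY
    exact ⟨isSiegelDelta_swap_inlLoc_swap (Fp L) L (IsCMField.complexConj L) v n' hJ rfl (complexConj_imagUnit L) (imagUnit_ne_zero L)
        (imagUnit_mul_self L) hT₀ hyy hsy hys (ch x) hgy hgb,
      fun w' => detDelta_swap_inlLoc_swap (Fp L) L (IsCMField.complexConj L) v n' hJ rfl (complexConj_imagUnit L) (imagUnit_ne_zero L)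
        hT₀ hyy hsy hys (ch x) hgy hgb w'⟩
  -- the eigenvalue of each member on `y`
  have hmemα : ∀ x ∈ Xp ∪ X0 ∪ {t₁⁻¹}, ∃ α : UnitaryGroup.LocalRing L v,
      (((localPiEquiv L (IsCMField.complexConj L) n' (Matrix.reindex e₁ e₁ (Matrix.diagonal dV ⊗ₖ JW (Fp L) L a)) v (ch x)).1 :
          GL (Fin n') (UnitaryGroup.LocalRing L v)).1) *ᵥ y = α • y := by
    intro x hx
    rcases Finset.mem_union.1 hx with hx | hx
    · rcases Finset.mem_union.1 hx with hx | hx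
      · exact ⟨αp, hXp x hx⟩
      · exact ⟨1, hX0 x hx⟩
    · rw [Finset.mem_singleton] at hx
      subst hx
      exact ⟨αm, hti⟩
  -- (4) a mover `m₀` of `ℓ_Δ` onto `ℓ_Y` (as ★ `F0P2oThetaJacquetTorusWeight`)
  have hTv : IsUnit (localGram (Fp L) (n' + n') (gramD (Fp L) n' T₀) v).det :=
    UnitaryGroup.isUnit_det_map (algebraMap (Fp L) (v.adicCompletion (Fp L))) (isUnit_det_gramD (Fp L) n' hT₀d)
  have hδ₀ := map_transportSp_deltaDiag_deltaLagrangian (Fp L) v n' (T₀ := T₀) hT₀d hTv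
    (SymplecticMatrix.mapHom (algebraMap (Fp L) (v.adicCompletion (Fp L))) (GRConstruction.deltaD L))
    (by
      rw [SymplecticMatrix.coe_mapHom]
      change (Matrix.reindex _ _ (deltaDiagMatrix (Fp L) (Fin n'))).map _ = _
      rw [Matrix.reindex_apply, Matrix.reindex_apply, ← Matrix.submatrix_map, deltaDiagMatrix_map])
  obtain ⟨m₀, hm₀'⟩ := MpPsi.proj_surjective _ (existsImplementer_localSchrodinger (Fp L) (n' + n') (gramD (Fp L) n' T₀)
    (isUnit_det_gramD (Fp L) n' hT₀d) v) (transportSp (localGram (Fp L) (n' + n') (gramD (Fp L) n' T₀) v) hTv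
      (SymplecticMatrix.mapHom (algebraMap (Fp L) (v.adicCompletion (Fp L))) (GRConstruction.deltaD L)))
  have hm₀ : (deltaLagrangian (Fp L) v n').map (toLin (Fp L) v (MpPsi.proj _ m₀)) = lagrangianY (Fp L) (n' + n') v := by
    rw [hm₀']; exact hδ₀
  -- (5) ★ (Λ-c) `w₀ ∈ H(𝒪_v)`, ★ (Λ-b) `λ′(1 ⊠ 1) ≠ 0`, ★ (Λ-a) extraction: `a₀ = Σ_x e_x`
  have hw₀K : w₀ ∈ UnitaryGroup.localInt L (IsCMField.complexConj L) (n' + n') ((gramD (Fp L) n' T₀).map (algebraMap (Fp L) L)) v :=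
    localSwapElt_swapVector_mem_localInt L (IsCMField.complexConj L) v n' rfl (complexConj_imagUnit L) (imagUnit_ne_zero L) _ hgood.gram hyI hysI _
  have hne := apply_zero_toRep_mul_localSplitting_boxSB_unitVec_ne_zero L v μ n' hT₀ hT₀d χ hχ m₀ hm₀ w₀ hgood hw₀K
  have hsum' : ∑ x ∈ Xp ∪ X0 ∪ {t₁⁻¹}, MpPsi.toRep (localSchrodinger (Fp L) n' T₀ v) (localSplittingCMWith L n' hT₀ hT₀d hJ χ hχ v μ (ch (id x))) Φ₁ =
      a₀ • Φ₁ := by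
    rw [← ha₀, hsum0]
    rfl
  have hextr := eq_sum_scalar_of_sum_toRep_localSplittingCMWith_eq_smul L v μ n' hT₀ hT₀d hJ χ hχ m₀ hm₀ w₀ hw₀ ch (Xp ∪ X0 ∪ {t₁⁻¹}) id
    (fun x hx => by obtain ⟨α, hα⟩ := hmemα x hx; exact (hSieg x α hα).1) Φ₁ a₀ hsum' Φ₁ hne
  simp only [id_eq] at hextr
  rw [hextr]
  -- (6) the scalars ★ (Σ-a): `e = Z q⁻¹ ∣ 1 ∣ Z⁻¹ q` on `X₊ ∣ X₀ ∣ t₁⁻¹`, disjoint pieces of sizes `q² ∣ q − 1 ∣ 1`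
  have hϖ0 : ϖ ≠ 0 := uniformizer_ne_zero hϖ
  have heXp : ∀ x ∈ Xp,
      (((LocalSplitting.chiDet (Fp L) L (IsCMField.complexConj L) v n' (fun w' : UnitaryGroup.PlacesOver L v => (χ.localComponent w'.1)⁻¹)
            (w₀ * inlLoc (Fp L) L (IsCMField.complexConj L) v n' hJ rfl (ch x) * w₀))⁻¹ : ℂˣ) : ℂ) *
        ((∏ w' : UnitaryGroup.PlacesOver L v, Real.sqrt ‖detDelta (Fp L) L (IsCMField.complexConj L) v n' w'
            (w₀ * inlLoc (Fp L) L (IsCMField.complexConj L) v n' hJ rfl (ch x) * w₀)‖ : ℝ) : ℂ) = Z * ((q : ℂ))⁻¹ := by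
    intro x hx
    rw [siegelScalar_eq_of_detDelta_eq L v w hw n' χ _ αp (hSieg x αp (hXp x hx)).2 hαp hϖ0, sqrt_norm_eq_inv L v w hw hv hϖ,
      Complex.ofReal_inv, Complex.ofReal_natCast]
  have heX0 : ∀ x ∈ X0,
      (((LocalSplitting.chiDet (Fp L) L (IsCMField.complexConj L) v n' (fun w' : UnitaryGroup.PlacesOver L v => (χ.localComponent w'.1)⁻¹)
            (w₀ * inlLoc (Fp L) L (IsCMField.complexConj L) v n' hJ rfl (ch x) * w₀))⁻¹ : ℂˣ) : ℂ) *
        ((∏ w' : UnitaryGroup.PlacesOver L v, Real.sqrt ‖detDelta (Fp L) L (IsCMField.complexConj L) v n' w'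
            (w₀ * inlLoc (Fp L) L (IsCMField.complexConj L) v n' hJ rfl (ch x) * w₀)‖ : ℝ) : ℂ) = 1 := by
    intro x hx
    exact scalar_eq_one_of_detDelta_eq_one L v n' χ _ fun w' => by rw [(hSieg x 1 (hX0 x hx)).2 w', Pi.one_apply]
  have heti :
      (((LocalSplitting.chiDet (Fp L) L (IsCMField.complexConj L) v n' (fun w' : UnitaryGroup.PlacesOver L v => (χ.localComponent w'.1)⁻¹)
            (w₀ * inlLoc (Fp L) L (IsCMField.complexConj L) v n' hJ rfl (ch t₁⁻¹) * w₀))⁻¹ : ℂˣ) : ℂ) *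
        ((∏ w' : UnitaryGroup.PlacesOver L v, Real.sqrt ‖detDelta (Fp L) L (IsCMField.complexConj L) v n' w'
            (w₀ * inlLoc (Fp L) L (IsCMField.complexConj L) v n' hJ rfl (ch t₁⁻¹) * w₀)‖ : ℝ) : ℂ) = Z⁻¹ * (q : ℂ) := by
    have hmk : Units.mk0 ϖ⁻¹ (inv_ne_zero hϖ0) = (Units.mk0 ϖ hϖ0)⁻¹ := Units.ext (by rw [Units.val_mk0, Units.val_inv_eq_inv_val, Units.val_mk0])
    rw [siegelScalar_eq_of_detDelta_eq L v w hw n' χ _ αm (hSieg t₁⁻¹ αm hti).2 hαm (inv_ne_zero hϖ0), sqrt_norm_inv_eq L v w hw hv hϖ,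
      Complex.ofReal_natCast, hmk, map_inv, Units.val_inv_eq_inv_val]
  -- disjointness of the three pieces (the eigenvalues `ϖ`, `1`, `ϖ⁻¹` on `y` are distinct)
  have hdisj₁ : Disjoint Xp X0 := by
    rw [Finset.disjoint_left]
    intro x hx hx'
    have h := congrFun (eq_of_mulVec_eq_smul_of_partner (IsCMField.complexConj L) v n' hsy (hXp x hx) (hX0 x hx')) w
    rw [hαp, Pi.one_apply] at h
    exact ne_one_of_valued L v w hϖ h
  have hdisj₂ : Disjoint (Xp ∪ X0) {t₁⁻¹} := by
    rw [Finset.disjoint_singleton_right, Finset.mem_union, not_or]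
    refine ⟨fun hx => ?_, fun hx => ?_⟩
    · have h := congrFun (eq_of_mulVec_eq_smul_of_partner (IsCMField.complexConj L) v n' hsy (hXp _ hx) hti) w
      rw [hαp, hαm] at h
      exact ne_inv_of_valued L v w hϖ h
    · have h := congrFun (eq_of_mulVec_eq_smul_of_partner (IsCMField.complexConj L) v n' hsy (hX0 _ hx) hti) w
      rw [hαm, Pi.one_apply] at h
      exact inv_ne_one_of_valued L v w hϖ h.symm
  rw [Finset.sum_union hdisj₂, Finset.sum_union hdisj₁, Finset.sum_singleton, Finset.sum_congr rfl heXp, Finset.sum_congr rfl heX0,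
    Finset.sum_const, Finset.sum_const, hcp, hc0, heti, nsmul_eq_mul, nsmul_eq_mul, mul_one]
  -- arithmetic: `q²·(Z q⁻¹) + (q − 1) + Z⁻¹ q = q(Z + Z⁻¹) + q − 1`
  have hq1 : 1 ≤ q := by
    rw [hqdef, HeightOneSpectrum.residueCard_eq_card_quotient]
    haveI : Finite (𝓞 (Fp L) ⧸ v.asIdeal) := Ideal.finiteQuotientOfFreeOfNeBot v.asIdeal v.ne_bot
    haveI : v.asIdeal.IsPrime := v.isPrime
    haveI : IsDomain (𝓞 (Fp L) ⧸ v.asIdeal) := Ideal.Quotient.isDomain v.asIdeal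
    exact Finite.one_lt_card.le
  have hq0 : (q : ℂ) ≠ 0 := Nat.cast_ne_zero.2 (by omega)
  have hZ0 : Z ≠ 0 := by rw [hZdef]; exact Units.ne_zero _
  simp only [← hqdef]
  rw [Nat.cast_sub hq1, Nat.cast_pow, Nat.cast_one]
  field_simp
  ring

end Summit.HodgeConjecture.HodgeConjecture.Cruxes.HLiu418.K2LiuInertThetaSphericalEigenvalue

end
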